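/-
Copyright (c) 2026 the pub-hodgecm-mathlib formalisation cell (harness21).  Prover seat hodgecm-mathlib-K2Liu-p05 (g8), Track B «K2-LIT»,
#184♮ = hLiu418 = `stmt-HodgeConjecture-24832`; #42F′ FACE-G organ F4 (G-gen), B3-b §2 LETTER FILE 3∕3 = THE `genFamily ∕ HasArchDeriv` READING (LEAD F0P6-plan (g14)
BATCH #140 (1); F4 lead K2Liu-p27 (g2) design 2026-09-04T23:26:22Z; consumer = the B3-b assembly `K2LiuArchSWDataInduction` (LH7-p07 (g2))).  THEOREMS ONLY (no `def`,
no `instance`, no notation, no local instance, no named-fact hypothesis, no `sorry`); lane `--supports stmt-HodgeConjecture-24832 --as helper`.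
-/
import Summits.HodgeConjecture.HodgeConjecture.Theorems.K2LiuArchSWPlaceTransportSection    -- ★ FILE 2∕2 (this seat): the character-twisted Fock transport
import Summits.HodgeConjecture.HodgeConjecture.Theorems.K2LiuFaceGLetterDefs                -- ★ `genFamily`, `HasArchDeriv` (FACE-G letter predicates, K2Liu-p10)
import HarnessLib

/-!
# Crux `HLiu418`, FACE-G organ F4 (G-gen), B3-b §2 letter file 3∕3: hGgen's (deriv) PREMISE BY NAME — `HasArchDeriv hX (genFamily x s₀) (genFamily x′ s₀)` for the
# polynomial-slot data `x = E(a ⊗ f)` (σ-slot `B⁻¹F`), `x′ = E(a′ ⊗ f)` (σ-slot `B⁻¹((c_X + η′_Y) • F + G)`)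

Cell `hodgecm-mathlib`, crux item hLiu418 = `stmt-HodgeConjecture-24832`; squad K2 ∕ K2Liu; prover K2Liu-p05 (g8); F4 lead K2Liu-p27 (g2), desk K2Liu-p10 (g6), box r02.
★ p862960 `K2LiuFaceGAssembler.faceG_of_organs`' third letter `hGgen` has the (deriv) clause «`Good V x → HasArchDeriv hX (fun h => genFamily … x s₀ h)
(fun h => genFamily … x′ s₀ h) → Good V′ x′`» in the predicates of ★ `K2LiuFaceGLetterDefs` (`genFamily Φ s h = detChar α h · stdExtension 𝒦 s₀ (swSectionTensor sB₀ Φ) s h`,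
`sB₀ = doubledWeilRep … χb`, `s₀ = (3 − n)∕2`).  THIS FILE reads ★ FILE 2∕2 `hasDerivAt_coe_mul_swSectionTensor_archExp_fock_of_weakDeriv` at `θ := detChar α`, `sB := sB₀`
(★ `isDoubledWeilRep_doubledWeilRep`) and `stdExtension_self` (`f_{s₀} = φ`) IN THOSE PREDICATES, at FACE-G's shapes `N = 2`, `M = 1`, `M₂ = 3`:
**`hasArchDeriv_genFamily_fock_of_weakDeriv`** — for the junction frames `eP eQ` at the real place `σ`, the one-place homomorphism `ψ` with (J2⊗-arch) identity `hsec`,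
`Y ∈ 𝔲(2,2)` with curve identity `hcurve : archExp hX s = archEmb (ψ (exp sY))` and character derivative `hθ : HasDerivAt (t ↦ detChar α (archExp hX t)) c 0` (★ F2
`hasDerivAt_coe_detChar_archExp`), Fock data `F` with weak derivative letter of value `B⁻¹G` (★ FILE 1∕2 `hasDerivAt_weilRepPair_expMem_boost ∕ _conj_boost` + ★
`exists_fock_hypOpGenC ∕ _rotBoostGen`), and `a` with `𝒥 a = (e_* B⁻¹F) ⊠ Φ₂`: for every `a′` with `𝒥 a′ = (e_* B⁻¹((c + η′_Y) • F + G)) ⊠ Φ₂`,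
`HasArchDeriv hX (fun h => genFamily … (E(a ⊗ f)) s₀ h) (fun h => genFamily … (E(a′ ⊗ f)) s₀ h)` — hGgen's (deriv) premise for B3-b's polynomial-slot tuples, by name.
References: [KudlaRallis1994, §1]; [Folland1989, §4.2 Prop. (4.39)]; [Howe1989, §3]; [GelbartRogawski1991, §3.1 Prop. 3.1.1]; [BorelJacquet1979, §4.1].
HONEST LABEL.  Count-neutral helper: `HC_CM` is proved only modulo the 7 printed citations (2 remaining named inputs: hLiu418 = `stmt-HodgeConjecture-24832`,
h413 = `stmt-HodgeConjecture-24833`) until rung 0 closes; this file closes no socket.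
-/

set_option autoImplicit false
set_option linter.dupNamespace false -- the mandated namespace repeats `HodgeConjecture.HodgeConjecture`

noncomputable section
open scoped Classical Matrix TensorProduct Kronecker SchwartzMap MatrixGroups
open NumberField NumberField.InfinitePlace NumberField.mixedEmbedding IsDedekindDomain
open Literature.Analysis.SegalBargmann Literature.Analysis.Distribution Literature.RepresentationTheory.HeisenbergGroup
open Literature.NumberTheory.Automorphic Literature.NumberTheory.Automorphic.UnitaryGroup Literature.NumberTheory.GaloisRepresentations
open Literature.NumberTheory.Weil1964 Literature.NumberTheory.Weil1964.MpS Literature.NumberTheory.Weil1964.UnitaryWeil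
open Literature.RepresentationTheory.HarrisKudlaSweet1996
open Literature.RepresentationTheory.KonnoKonno2007 hiding LetterKind letterOf letterGen letterOf_boost letterOf_torus letterOf_torus_eq
  letterGen_boost letterGen_torus letterGen_mem_lie exp_smul_letterGen
open Literature.RepresentationTheory.KonnoKonno2007.RealDualPair Literature.NumberTheory.K2Lit.SiegelDoubled
open Literature.NumberTheory.GelbartRogawski1991 Literature.NumberTheory.GelbartRogawski1991.GRConstruction Literature.NumberTheory.GelbartRogawski1991.UnitaryDualPair
open Literature.NumberTheory.GelbartRogawski1991.UnitaryDualPair.LocalSplitting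
open Literature.NumberTheory.Automorphic.Liu2021 Literature.NumberTheory.Automorphic.Liu2021.Def411WeilCarriers Literature.NumberTheory.Automorphic.Liu2021.Def411WeilCarriersDoubling
open Summit.HodgeConjecture.HodgeConjecture.Cruxes.HLiu418.K2LiuArchSectionPlaceBlock
open Summit.HodgeConjecture.HodgeConjecture.Cruxes.HLiu418 (K2LiuArchOneParameterOrbitDefs.archEmb K2LiuArchOneParameterOrbitDefs.archExp)
open Summit.HodgeConjecture.HodgeConjecture.Cruxes.HLiu418.K2LiuSwSectionArchOrbit Summit.HodgeConjecture.HodgeConjecture.Cruxes.HLiu418.K2LiuArchWeilJunctionTransport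
open Summit.HodgeConjecture.HodgeConjecture.Cruxes.HLiu418.K2LiuFaceGLetterDefs (genFamily HasArchDeriv)
open Summit.HodgeConjecture.HodgeConjecture.Cruxes.HLiu418.K2LiuArchSWPlaceTransportSection (hasDerivAt_coe_mul_swSectionTensor_archExp_fock_of_weakDeriv)

namespace Summit.HodgeConjecture.HodgeConjecture.Cruxes.HLiu418.K2LiuArchSWPlaceTransportGenFamily

variable (L : Type) [Field L] [NumberField L] [IsCMField L]
variable {n : ℕ} (e : Fin 2 × Fin 1 ≃ Fin n)
  (dV : Fin 2 → L) (hdV : ∀ i, IsCMField.complexConj L (dV i) = dV i) (hdV0 : ∀ i, dV i ≠ 0)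
  (dW : Fin 1 → L) (hdW : ∀ i, IsCMField.complexConj L (dW i) = dW i) (hdW0 : ∀ i, dW i ≠ 0)
variable {M' n' : ℕ} (eW : Fin 1 × Fin 3 ≃ Fin M') (e' : Fin 2 × Fin M' ≃ Fin n')
  (dV' : Fin 3 → L) (hdV' : ∀ k, IsCMField.complexConj L (dV' k) = dV' k) (hdV'0 : ∀ k, dV' k ≠ 0)
variable (σ : {v : InfinitePlace (Fp L) // v.IsReal})
  {R S : Type} [Fintype R] [DecidableEq R] [Fintype S] [DecidableEq S]
  (eP : PosIdx (signVec (cmPlaceOver L) (fun k => Sum.elim (cmGramEntry L e' dV hdV (tensorFrame L dW eW dV') (tensorFrame_real L dW hdW eW dV' hdV')) (-cmGramEntry L e' dV hdV (tensorFrame L dW eW dV') (tensorFrame_real L dW hdW eW dV' hdV')) ((LocalSplitting.e₂ n').symm k)) (imagUnit L) σ) ≃ (Fin 2 × R) ⊕ (Fin 2 × S))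
  (eQ : NegIdx (signVec (cmPlaceOver L) (fun k => Sum.elim (cmGramEntry L e' dV hdV (tensorFrame L dW eW dV') (tensorFrame_real L dW hdW eW dV' hdV')) (-cmGramEntry L e' dV hdV (tensorFrame L dW eW dV') (tensorFrame_real L dW hdW eW dV' hdV')) ((LocalSplitting.e₂ n').symm k)) (imagUnit L) σ) ≃ (Fin 2 × S) ⊕ (Fin 2 × R))
  {X : Matrix (Fin (n + n)) (Fin (n + n)) (mixedSpace L)}
  (hX : X ∈ archSkew (Fp L) L (IsCMField.complexConj L) (n + n) (hermD L e dV hdV dW hdW))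

-- the doubled metaplectic carriers of socket #42F′ elaborate slowly (as ★ `K2LiuFaceGLetterDefs` ∕ ★ (r-b): 4 000 000 heartbeats on the STATEMENT)
set_option maxHeartbeats 4000000

include hdW0 hdV'0 in
/-- **hGgen's (deriv) PREMISE FOR THE POLYNOMIAL-SLOT TUPLES OF B3-b, BY NAME.**  See the module docstring: ★ FILE 2∕2's character-twisted Fock transport at `θ := detChar α`,
`sB := doubledWeilRep … χb` (★ `isDoubledWeilRep_doubledWeilRep`), read in ★ `K2LiuFaceGLetterDefs.{genFamily, HasArchDeriv}` through `stdExtension_self`.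
[cite: KudlaRallis1994, §1] [cite: Folland1989, §4.2 Prop. (4.39)] [cite: GelbartRogawski1991, §3.1 Prop. 3.1.1] [cite: BorelJacquet1979, §4.1] -/
theorem hasArchDeriv_genFamily_fock_of_weakDeriv
    (χb : HeckeCharacter L) (hχbu : χb.IsUnitary) (hχbs : IsSplittingChar L 1 χb) {t : InfinitePlace L → ℤ} (ht : χb.HasUnitaryArchType t 0) (hodd : ∀ w, Odd (t w))
    (α : UnitaryGroup.adelicOne (Fp L) L (IsCMField.complexConj L) →* ℂˣ) (𝒦 : IwasawaDatum L e dV hdV dW hdW)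
    (f : FinSB (Fp L) (Fin (n' + n')))
    (ψ : UForm (Fin 2) (Fin 2) →* UnitaryGroup.arch (Fp L) L (IsCMField.complexConj L) (n + n) (hermD L e dV hdV dW hdW))
    (hsec : ∀ h : UForm (Fin 2) (Fin 2),
      tensorEmb L e dV hdV dW hdW eW e' dV' hdV' (K2LiuArchOneParameterOrbitDefs.archEmb (Fp L) L (IsCMField.complexConj L) (n + n) (hermD L e dV hdV dW hdW) (ψ h)) =
        K2LiuArchOneParameterOrbitDefs.archEmb (Fp L) L (IsCMField.complexConj L) (n' + n') (hermD L e' dV hdV (tensorFrame L dW eW dV') (tensorFrame_real L dW hdW eW dV' hdV'))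
          (placeSecJ L (IsCMField.complexConj L) (n' + n') (IsCMField.complexConj_ne_one L) (cmPlaceOver L) (cmPlaceOver_smul L) _ (gramD_gram_realDiagonal_entry_ne_zero L e' dV hdV (tensorFrame L dW eW dV') (tensorFrame_real L dW hdW eW dV' hdV') hdV0 (tensorFrame_ne_zero L dW eW dV' hdW0 hdV'0)) (complexConj_imagUnit L)
            (imagUnit_ne_zero L) σ (cmPlaceOver_comap L) (gramD_eq_diagonal_cm L e' dV hdV (tensorFrame L dW eW dV') (tensorFrame_real L dW hdW eW dV' hdV')) (J := hermD L e' dV hdV (tensorFrame L dW eW dV') (tensorFrame_real L dW hdW eW dV' hdV')) rfl (complexConj_smul_infinitePlace L) eP eQ ((toBig (Fin 2) (Fin 2) R S (h, 1), (1 : UForm Unit Empty)) : Ginf ((Fin 2 × R) ⊕ (Fin 2 × S)) ((Fin 2 × S) ⊕ (Fin 2 × R)) Unit Empty)))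
    (Y : letI : LieRing (Matrix (Fin 2 ⊕ Fin 2) (Fin 2 ⊕ Fin 2) ℂ) := LieRing.ofAssociativeRing; ↥(uFormGroup (Fin 2) (Fin 2)).lie.toSubmodule)
    (hcurve : letI : LieRing (Matrix (Fin 2 ⊕ Fin 2) (Fin 2 ⊕ Fin 2) ℂ) := LieRing.ofAssociativeRing
      ∀ s : ℝ, K2LiuArchOneParameterOrbitDefs.archExp (Fp L) L (IsCMField.complexConj L) (n + n) (hermD L e dV hdV dW hdW) hX s = K2LiuArchOneParameterOrbitDefs.archEmb (Fp L) L (IsCMField.complexConj L) (n + n) (hermD L e dV hdV dW hdW) (ψ ((uFormGroup (Fin 2) (Fin 2)).expMem ⟨((s • Y : ↥(uFormGroup (Fin 2) (Fin 2)).lie.toSubmodule) : Matrix (Fin 2 ⊕ Fin 2) (Fin 2 ⊕ Fin 2) ℂ), (s • Y).2⟩ : UForm (Fin 2) (Fin 2))))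
    {c : ℂ} (hθ : HasDerivAt (fun t' : ℝ => (((DoubledWeilDetTwist.detChar L e dV hdV hdV0 dW hdW hdW0 α) (K2LiuArchOneParameterOrbitDefs.archExp (Fp L) L (IsCMField.complexConj L) (n + n) (hermD L e dV hdV dW hdW) hX t') : ℂˣ) : ℂ)) c 0)
    (F G : MvPolynomial (DPIdx (Fin 2) (Fin 2) R S) ℂ)
    (hG : letI : LieRing (Matrix (Fin 2 ⊕ Fin 2) (Fin 2 ⊕ Fin 2) ℂ) := LieRing.ofAssociativeRing
      ∀ T : 𝓢((DPIdx (Fin 2) (Fin 2) R S → ℝ), ℂ) →L[ℝ] ℂ,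
      HasDerivAt (fun s : ℝ => T (((weilRep (α := (Fin 2 × R) ⊕ (Fin 2 × S)) (β := (Fin 2 × S) ⊕ (Fin 2 × R))).comp (toBig (Fin 2) (Fin 2) R S)) ((((uFormGroup (Fin 2) (Fin 2)).expMem ⟨((s • Y : ↥(uFormGroup (Fin 2) (Fin 2)).lie.toSubmodule) : Matrix (Fin 2 ⊕ Fin 2) (Fin 2 ⊕ Fin 2) ℂ), (s • Y).2⟩ : UForm (Fin 2) (Fin 2)), (1 : UForm R S)) : Ginf (Fin 2) (Fin 2) R S) (binvPi F))) (T (binvPi G)) 0)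
    (Φ₂ : 𝓢(((Fin (n' + n') × {v : {v : InfinitePlace (Fp L) // v.IsReal} // v ≠ σ}) → ℝ), ℂ)) {a : 𝓢((Fin (n' + n') → mixedSpace (Fp L)), ℂ)}
    (ha : ((((schwartzTransport (scaledFrame (Fp L) (Fin (n' + n')) (placeScale (n' + n') fun v => sqrtAbs (signVec (cmPlaceOver L) (fun k => Sum.elim (cmGramEntry L e' dV hdV (tensorFrame L dW eW dV') (tensorFrame_real L dW hdW eW dV' hdV')) (-cmGramEntry L e' dV hdV (tensorFrame L dW eW dV') (tensorFrame_real L dW hdW eW dV'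
          hdV')) ((LocalSplitting.e₂ n').symm k)) (imagUnit L) v)) (placeScale_ne_zero (n' + n') (sqrtAbs_signVec_ne_zero (IsCMField.complexConj_ne_one L) (cmPlaceOver_smul L) (complexConj_imagUnit L) (imagUnit_ne_zero L) (gramD_gram_realDiagonal_entry_ne_zero L e' dV hdV (tensorFrame L dW eW dV') (tensorFrame_real L dW hdW eW
          dV' hdV') hdV0 (tensorFrame_ne_zero L dW eW dV' hdW0 hdV'0)))))).trans (schwartzTransport (reindexCLE (placeSplitEquiv (signSplit (signVec (cmPlaceOver L) (fun k => Sum.elim (cmGramEntry L e' dV hdV (tensorFrame L dW eW dV') (tensorFrame_real L dW hdW eW dV' hdV')) (-cmGramEntry L e' dV hdV (tensorFrame L dW eW dV')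
          (tensorFrame_real L dW hdW eW dV' hdV')) ((LocalSplitting.e₂ n').symm k)) (imagUnit L) σ)) σ)))).trans (schwartzTransport (reindexCLE (Equiv.sumCongr (unitJunctionIdx (PosIdx (signVec (cmPlaceOver L) (fun k => Sum.elim (cmGramEntry L e' dV hdV (tensorFrame L dW eW dV') (tensorFrame_real L dW hdW eW dV' hdV'))
          (-cmGramEntry L e' dV hdV (tensorFrame L dW eW dV') (tensorFrame_real L dW hdW eW dV' hdV')) ((LocalSplitting.e₂ n').symm k)) (imagUnit L) σ)) (NegIdx (signVec (cmPlaceOver L) (fun k => Sum.elim (cmGramEntry L e' dV hdV (tensorFrame L dW eW dV') (tensorFrame_real L dW hdW eW dV' hdV')) (-cmGramEntry L e' dV hdV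
          (tensorFrame L dW eW dV') (tensorFrame_real L dW hdW eW dV' hdV')) ((LocalSplitting.e₂ n').symm k)) (imagUnit L) σ))).symm (Equiv.refl (Fin (n' + n') × {v : {v : InfinitePlace (Fp L) // v.IsReal} // v ≠ σ})))))).trans (schwartzTransport (reindexCLE (Equiv.sumCongr (dpIdxCongr (PosIdx (signVec (cmPlaceOver L) (fun k
          => Sum.elim (cmGramEntry L e' dV hdV (tensorFrame L dW eW dV') (tensorFrame_real L dW hdW eW dV' hdV')) (-cmGramEntry L e' dV hdV (tensorFrame L dW eW dV') (tensorFrame_real L dW hdW eW dV' hdV')) ((LocalSplitting.e₂ n').symm k)) (imagUnit L) σ)) (NegIdx (signVec (cmPlaceOver L) (fun k => Sum.elim (cmGramEntry L e'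
          dV hdV (tensorFrame L dW eW dV') (tensorFrame_real L dW hdW eW dV' hdV')) (-cmGramEntry L e' dV hdV (tensorFrame L dW eW dV') (tensorFrame_real L dW hdW eW dV' hdV')) ((LocalSplitting.e₂ n').symm k)) (imagUnit L) σ)) Unit Empty ((Fin 2 × R) ⊕ (Fin 2 × S)) ((Fin 2 × S) ⊕ (Fin 2 × R)) Unit Empty eP eQ (Equiv.refl Unit)
          (Equiv.refl Empty)).symm (Equiv.refl (Fin (n' + n') × {v : {v : InfinitePlace (Fp L) // v.IsReal} // v ≠ σ})))))) a = tensorPi ((schwartzTransport (reindexCLE (unitJunctionIdx ((Fin 2 × R) ⊕ (Fin 2 × S)) ((Fin 2 × S) ⊕ (Fin 2 × R))).symm)) (binvPi F)) Φ₂) :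
    letI : LieRing (Matrix (Fin 2 ⊕ Fin 2) (Fin 2 ⊕ Fin 2) ℂ) := LieRing.ofAssociativeRing
    ∀ a' : 𝓢((Fin (n' + n') → mixedSpace (Fp L)), ℂ),
      ((((schwartzTransport (scaledFrame (Fp L) (Fin (n' + n')) (placeScale (n' + n') fun v => sqrtAbs (signVec (cmPlaceOver L) (fun k => Sum.elim (cmGramEntry L e' dV hdV (tensorFrame L dW eW dV') (tensorFrame_real L dW hdW eW dV' hdV')) (-cmGramEntry L e' dV hdV (tensorFrame L dW eW dV') (tensorFrame_real L dW hdW eW dV'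
          hdV')) ((LocalSplitting.e₂ n').symm k)) (imagUnit L) v)) (placeScale_ne_zero (n' + n') (sqrtAbs_signVec_ne_zero (IsCMField.complexConj_ne_one L) (cmPlaceOver_smul L) (complexConj_imagUnit L) (imagUnit_ne_zero L) (gramD_gram_realDiagonal_entry_ne_zero L e' dV hdV (tensorFrame L dW eW dV') (tensorFrame_real L dW hdW eW
          dV' hdV') hdV0 (tensorFrame_ne_zero L dW eW dV' hdW0 hdV'0)))))).trans (schwartzTransport (reindexCLE (placeSplitEquiv (signSplit (signVec (cmPlaceOver L) (fun k => Sum.elim (cmGramEntry L e' dV hdV (tensorFrame L dW eW dV') (tensorFrame_real L dW hdW eW dV' hdV')) (-cmGramEntry L e' dV hdV (tensorFrame L dW eW dV')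
          (tensorFrame_real L dW hdW eW dV' hdV')) ((LocalSplitting.e₂ n').symm k)) (imagUnit L) σ)) σ)))).trans (schwartzTransport (reindexCLE (Equiv.sumCongr (unitJunctionIdx (PosIdx (signVec (cmPlaceOver L) (fun k => Sum.elim (cmGramEntry L e' dV hdV (tensorFrame L dW eW dV') (tensorFrame_real L dW hdW eW dV' hdV'))
          (-cmGramEntry L e' dV hdV (tensorFrame L dW eW dV') (tensorFrame_real L dW hdW eW dV' hdV')) ((LocalSplitting.e₂ n').symm k)) (imagUnit L) σ)) (NegIdx (signVec (cmPlaceOver L) (fun k => Sum.elim (cmGramEntry L e' dV hdV (tensorFrame L dW eW dV') (tensorFrame_real L dW hdW eW dV' hdV')) (-cmGramEntry L e' dV hdV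
          (tensorFrame L dW eW dV') (tensorFrame_real L dW hdW eW dV' hdV')) ((LocalSplitting.e₂ n').symm k)) (imagUnit L) σ))).symm (Equiv.refl (Fin (n' + n') × {v : {v : InfinitePlace (Fp L) // v.IsReal} // v ≠ σ})))))).trans (schwartzTransport (reindexCLE (Equiv.sumCongr (dpIdxCongr (PosIdx (signVec (cmPlaceOver L) (fun k
          => Sum.elim (cmGramEntry L e' dV hdV (tensorFrame L dW eW dV') (tensorFrame_real L dW hdW eW dV' hdV')) (-cmGramEntry L e' dV hdV (tensorFrame L dW eW dV') (tensorFrame_real L dW hdW eW dV' hdV')) ((LocalSplitting.e₂ n').symm k)) (imagUnit L) σ)) (NegIdx (signVec (cmPlaceOver L) (fun k => Sum.elim (cmGramEntry L e'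
          dV hdV (tensorFrame L dW eW dV') (tensorFrame_real L dW hdW eW dV' hdV')) (-cmGramEntry L e' dV hdV (tensorFrame L dW eW dV') (tensorFrame_real L dW hdW eW dV' hdV')) ((LocalSplitting.e₂ n').symm k)) (imagUnit L) σ)) Unit Empty ((Fin 2 × R) ⊕ (Fin 2 × S)) ((Fin 2 × S) ⊕ (Fin 2 × R)) Unit Empty eP eQ (Equiv.refl Unit)
          (Equiv.refl Empty)).symm (Equiv.refl (Fin (n' + n') × {v : {v : InfinitePlace (Fp L) // v.IsReal} // v ≠ σ})))))) a' = tensorPi ((schwartzTransport (reindexCLE (unitJunctionIdx ((Fin 2 × R) ⊕ (Fin 2 × S)) ((Fin 2 × S) ⊕ (Fin 2 × R))).symm)) (binvPi ((c + (deriv (fun s : ℝ => (((etaD L e' dV hdV (tensorFrame L dW eW dV') (tensorFrame_real L dW hdW eW dV' hdV') t (placeSecJ L (IsCMField.complexConj L) (n' + n') (IsCMField.complexConj_ne_one L) (cmPlaceOver L) (cmPlaceOver_smul L) _ (gramD_gram_realDiagonal_entry_ne_zero L e' dV hdV (tensorFrame L dW eW dV') (tensorFrame_real L dW hdW eW dV'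 hdV') hdV0 (tensorFrame_ne_zero L dW eW dV' hdW0 hdV'0)) (complexConj_imagUnit L)
            (imagUnit_ne_zero L) σ (cmPlaceOver_comap L) (gramD_eq_diagonal_cm L e' dV hdV (tensorFrame L dW eW dV') (tensorFrame_real L dW hdW eW dV' hdV')) (J := hermD L e' dV hdV (tensorFrame L dW eW dV') (tensorFrame_real L dW hdW eW dV' hdV')) rfl (complexConj_smul_infinitePlace L) eP eQ
            ((toBig (Fin 2) (Fin 2) R S (((uFormGroup (Fin 2) (Fin 2)).expMem ⟨((s • Y : ↥(uFormGroup (Fin 2) (Fin 2)).lie.toSubmodule) : Matrix (Fin 2 ⊕ Fin 2) (Fin 2 ⊕ Fin 2) ℂ), (s • Y).2⟩ : UForm (Fin 2) (Fin 2)), 1), (1 : UForm Unit Empty)) : Ginf ((Fin 2 × R) ⊕ (Fin 2 × S)) ((Fin 2 × S) ⊕ (Fin 2 × R)) Unit Empty)) : ℂˣ) : ℂ))) 0)) • F + G))) Φ₂ →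
      HasArchDeriv L e dV hdV dW hdW hX (fun h => genFamily L e dV hdV hdV0 dW hdW hdW0 eW e' dV' hdV' hdV'0 χb hχbu hχbs α 𝒦 (piSchwartzBruhatEquiv (Fp L) (Fin (n' + n')) (a ⊗ₜ f)) ((((3 : ℕ) : ℂ) - (n : ℂ)) / 2) h) (fun h => genFamily L e dV hdV hdV0 dW hdW hdW0 eW e' dV' hdV' hdV'0 χb hχbu hχbs α 𝒦 (piSchwartzBruhatEquiv (Fp L) (Fin (n' + n')) (a' ⊗ₜ f)) ((((3 : ℕ) : ℂ) - (n : ℂ)) / 2) h) := by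
  letI : LieRing (Matrix (Fin 2 ⊕ Fin 2) (Fin 2 ⊕ Fin 2) ℂ) := LieRing.ofAssociativeRing
  intro a' ha'
  unfold HasArchDeriv genFamily
  intro h
  simp only [stdExtension_self]
  exact hasDerivAt_coe_mul_swSectionTensor_archExp_fock_of_weakDeriv L e dV hdV hdV0 dW hdW hdW0 eW e' dV' hdV' hdV'0 σ eP eQ hX hχbu hχbs
    (isDoubledWeilRep_doubledWeilRep L e' dV hdV hdV0 (tensorFrame L dW eW dV') (tensorFrame_real L dW hdW eW dV' hdV') (tensorFrame_ne_zero L dW eW dV' hdW0 hdV'0) χb hχbu hχbs) ht hodd f ψ hsec Y hcurve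
    (DoubledWeilDetTwist.detChar L e dV hdV hdV0 dW hdW hdW0 α) hθ F G hG Φ₂ ha a' ha' h

end Summit.HodgeConjecture.HodgeConjecture.Cruxes.HLiu418.K2LiuArchSWPlaceTransportGenFamily

end
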